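import Literature.Geometry.Lorentzian.KerrSlope
import HarnessLib

/-!
# The slope field on the two-sided Kerr horizon collar in a time-oriented spacetime

For a chart `Φ` of any time-oriented `Spacetime 4` on a model background `B` whose form / time /
radius are those of the boosted Kerr–Schild background with motion `(Λ, c)` and whose domain contains
`{r > r₊ − h}` (`0 < M`, `|a| < M`, `h > 0`): GIVEN the `C¹` deviation bound
`‖Φ^*g − g_B‖_{C¹} ≤ ε` on the late slabs `{t* ≥ τ₁, r ≤ r₊ + h}` and the ANCHOR «at every late
horizon leaf point `w₀` (`r = r₊`) some rest vector `v₀`, `v₀⁰ > 0`, has `Φ^*g(Λv₀, Λv₀) ≤ 0` and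
`dr(v₀) ≥ 0`» (the conclusion of `KerrAnchor.horizonLeafAnchor_model`), PRODUCE at every late collar
point `w` (`r₊ < r ≤ r₊ + h`) a rest vector `v`, `v⁰ = 1`, `‖v‖ ≤ K`, with `Φ^*g(Λv, Λv) ≤ −cₛ d` and
`dr(v) ≥ cₛ d`, `d = r − r₊` — `ε, cₛ, K` depending on `(Λ, c, M, a, h)` only
(`KerrSlope.collarSlope_model`).  Two halves (DRSR arXiv:1402.7034 §2.2.2 / Lemma 4.7.2 made
quantitative in Kerr–Schild coordinates):

* §3 BULK `r₊ + d₁ ≤ r ≤ r₊ + h` (`bulk_slope`, any `|a| ≤ M`): the normalised bulk vector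
  `u = V + (4HΣ/Δ)·W` of `KerrSlope` is uniformly timelike with `dr(u⃗) = 2H ≥ η₀ > 0` and bounded on
  the compact time-normalised shell, so `ε = 1/(2‖Λ‖²U⁴)` absorbs the deviation;
* §4 LAYER `r₊ < r ≤ r₊ + d₁` (`layer_slope`, the red-shift half): foot point `w₀ = w − dΛn` on the
  horizon leaf, anchor `v₀`, `v₁ = v₀/v₀⁰ = K₀ + e`; coercivity and the horizon identities give
  `|e| ≤ C_e √ε`; the candidate `v = K_q + e + μd·n` has
  `Φ^*g_w(Λv,Λv) ≤ g_q(K,K) + O(√ε + μ + μ²d₁) d ≤ −(c₀/2) d` by the red shift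
  `g_q(K_q,K_q) ≤ −c₀ d` («KerrHorizonRedShiftLinear»), the `C¹` deviation bound integrated along
  `[w₀, w]` and Lipschitz bounds of `g_{M,a}`, `dr` on the compact shell (the cross term
  `2μd·g(K + e, n)` has the bad sign and is paid by `μ = c₀/(8 C_G C_K)`), while `dr(K⃗_q) = 0`
  exactly gives `dr(v⃗) ≥ (μ/2) d`;
* §5 `collarSlope_model` glues the halves (`ε = min`, `cₛ = min`, `K = max`).

Provenance: decomp-fsc lens-3 g34 side file `CollarSlope34.lean` ll. 969–1110, 1114–1157 and
1222–1784 (farm-checked there, every proof inside the default heartbeat budget), re-homed verbatim on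
top of `KerrPeel` / `KerrSlope`; the generic bilinear-algebra helpers are private here.
References: DRSR arXiv:1402.7034, §2.2.2, Lemma 4.7.2; DHRT arXiv:2104.08222, §1; Visser
arXiv:0706.0622, (32)–(35); Wald 1984, §12.3, §12.5.

NOT here: the route-side corollary for vacuum Cauchy developments (a Theses-side 4-liner), the
anchor (`KerrAnchor`), the climb (`KerrPeelClimb`).
-/

noncomputable section

open scoped Topology Manifold ContDiff ENNReal
open Filter Set Function

namespace Literature.Geometry.Lorentzian

namespace KerrSlope

open Metric KerrPeel

-- typeclass search through nested operator types `E4 →L[ℝ] E4 →L[ℝ] ℝ` (as in `BoostedKerrCausalLegs`)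
set_option maxSynthPendingDepth 3

variable {M a : ℝ} {x : E4}

/-! #### Generic analysis helpers (private) -/

/-- **Lipschitz bound on segments inside a compact set** for a map that is `C¹` at every point of the
set (`sup ‖Df‖` over the compact set + the mean value inequality). [folklore] -/
private theorem exists_lipschitz_of_contDiffAt {E F : Type*} [NormedAddCommGroup E] [NormedSpace ℝ E]
    [NormedAddCommGroup F] [NormedSpace ℝ F] {f : E → F} {K : Set E} (hK : IsCompact K)
    (hf : ∀ x ∈ K, ContDiffAt ℝ 1 f x) :
    ∃ L : ℝ, 0 ≤ L ∧ ∀ x y : E, segment ℝ x y ⊆ K → ‖f y - f x‖ ≤ L * ‖y - x‖ := by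
  have hcont : ContinuousOn (fderiv ℝ f) K := fun x hx =>
    ((hf x hx).fderiv_right (m := 0) (by norm_num)).continuousAt.continuousWithinAt
  obtain ⟨L, hL⟩ := hK.exists_bound_of_continuousOn hcont
  refine ⟨max L 0, le_max_right _ _, fun x y hseg => ?_⟩
  exact Convex.norm_image_sub_le_of_norm_fderiv_le (𝕜 := ℝ) (f := f) (s := segment ℝ x y)
    (fun z hz => (hf z (hseg hz)).differentiableAt one_ne_zero)
    (fun z hz => (hL z (hseg hz)).trans (le_max_left _ _))
    (convex_segment x y) (left_mem_segment ℝ x y) (right_mem_segment ℝ x y)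

/-! #### Algebra of bilinear forms -/

/-- `g(A + B + tC, A + B + tC)` expanded (`g` symmetric). [folklore] -/
private theorem kerr_expand3 (M a : ℝ) (x A B C : E4) (t : ℝ) :
    Kerr.bilin M a x (A + B + t • C) (A + B + t • C) =
      Kerr.bilin M a x A A + 2 * Kerr.bilin M a x A B + Kerr.bilin M a x B B +
      t * (2 * Kerr.bilin M a x A C + 2 * Kerr.bilin M a x B C) + t ^ 2 * Kerr.bilin M a x C C := by
  have hs := Kerr.bilin_symm M a x
  simp only [map_add, map_smul, add_apply, smul_apply, smul_eq_mul]
  rw [hs B A, hs C A, hs C B]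
  ring

/-- `g(A + B, A + B) = g(A,A) + 2g(A,B) + g(B,B)` (`g` symmetric). [folklore] -/
private theorem kerr_expand2 (M a : ℝ) (x A B : E4) :
    Kerr.bilin M a x (A + B) (A + B) =
      Kerr.bilin M a x A A + 2 * Kerr.bilin M a x A B + Kerr.bilin M a x B B := by
  have hs := Kerr.bilin_symm M a x
  simp only [map_add, add_apply]
  rw [hs B A]
  ring

/-- `D(X, X) = D(Y, Y) + D(X − Y, X) + D(Y, X − Y)` for any bilinear `D`. [folklore] -/
private theorem clm₂_self_sub (D : E4 →L[ℝ] E4 →L[ℝ] ℝ) (X Y : E4) :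
    D X X = D Y Y + D (X - Y) X + D Y (X - Y) := by
  simp only [map_sub, sub_apply]
  ring

/-- Absorption: `e² ≤ (t (C + e))²`, `0 ≤ t ≤ 1/2` ⇒ `e ≤ 2tC`. [folklore] -/
private theorem le_of_sq_le_absorb {e t C : ℝ} (he : 0 ≤ e) (ht : 0 ≤ t) (ht2 : t ≤ 1 / 2) (hC : 0 ≤ C)
    (h : e ^ 2 ≤ (t * (C + e)) ^ 2) : e ≤ 2 * t * C := by
  have h1 : e ≤ t * (C + e) := (pow_le_pow_iff_left₀ he (by positivity) two_ne_zero).1 h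
  have h2 : t * e ≤ (1 / 2) * e := mul_le_mul_of_nonneg_right ht2 he
  nlinarith

/-! ### §3 The bulk slope -/

section Engine

variable (𝓢 : Spacetime.{0} 4)
set_option maxHeartbeats 400000 in -- buildfix (bf3-g31): 160k/180k FAIL, 200k PASS at accept time; line-neutral budget line
/-- **Bulk slope** (the easy half of (T)): on `r₊ + d₁ ≤ r ≤ r₊ + h` the normalised vector
`v = u/u⁰`, `u = V + (4HΣ/Δ)W`, has `v⁰ = 1`, `‖v‖ ≤ U` (compactness of the time-normalised shell),
`g_{M,a}(v, v) = −(1 + 2H)/(u⁰)² ≤ −1/U²` and `dr(v) = 2H/u⁰ ≥ η₀/U`; with `ε = 1/(2‖Λ‖²U⁴)` the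
`C⁰` deviation costs at most `1/(2U²)`, so `Φ^*g(Λv, Λv) ≤ −1/(2U²) ≤ −cₛ (r − r₊)` and
`dr(v) ≥ η₀/U ≥ cₛ (r − r₊)` for `cₛ = min(1/(2U²h), η₀/(Uh))`. [cite: arXiv07060622, (32)–(33)] -/
theorem bulk_slope (B : ModelBackground) (Λ : lorentzGroup) (c : E4) {M : ℝ} (a : ℝ) (hM : 0 < M)
    (ha : |a| ≤ M) {h : ℝ} (hh : 0 < h)
    (hBb : B.bilin = boostedKerrBilin Λ c M a)
    (hBr : ∀ x, B.radius x = Kerr.radius a (poincareInv Λ c x)) {d₁ : ℝ} (hd₁ : 0 < d₁) :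
    ∃ ε : ℝ, 0 < ε ∧ ∃ cₛ : ℝ, 0 < cₛ ∧ ∃ K : ℝ,
    ∀ Φ : B.domain → 𝓢.carrier,
    ∀ τ₁ : ℝ,
    (∀ τ : ℝ, τ₁ ≤ τ → 𝓢.truncDeviationCk B Φ 1 (Kerr.rPlus M a + h) τ ≤ ENNReal.ofReal ε) →
    ∀ w : B.domain, τ₁ ≤ B.time w.1 → Kerr.rPlus M a + d₁ ≤ B.radius w.1 →
      B.radius w.1 ≤ Kerr.rPlus M a + h →
      ∃ v : E4, v 0 = 1 ∧ ‖v‖ ≤ K ∧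
        𝓢.metric.val (Φ w) (mfderiv 𝓘(ℝ, E4) (𝓡 4) Φ w ((Λ : E4 ≃L[ℝ] E4) v))
          (mfderiv 𝓘(ℝ, E4) (𝓡 4) Φ w ((Λ : E4 ≃L[ℝ] E4) v)) ≤
          -(cₛ * (B.radius w.1 - Kerr.rPlus M a)) ∧
        cₛ * (B.radius w.1 - Kerr.rPlus M a) ≤
          Kerr.radiusGrad a (E4.spatial (poincareInv Λ c w.1)) (E4.spatial v) := by
  have hrpM : M ≤ Kerr.rPlus M a := le_rPlus M a
  have hrp : 0 < Kerr.rPlus M a := hM.trans_le hrpM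
  -- the Lorentz part of the motion
  set KΛ : ℝ := ‖((Λ : E4 ≃L[ℝ] E4) : E4 →L[ℝ] E4)‖ with hKΛ_def
  have hKΛ : 1 ≤ KΛ := BoostedKerrLegs.one_le_norm_lorentz Λ
  have hΛle : ∀ v : E4, ‖(Λ : E4 ≃L[ℝ] E4) v‖ ≤ KΛ * ‖v‖ := fun v =>
    ((Λ : E4 ≃L[ℝ] E4) : E4 →L[ℝ] E4).le_opNorm v
  -- a uniform bound `U` for `‖u‖` on the time-normalised shell
  have hSc : IsCompact (shell a (Kerr.rPlus M a + d₁) (Kerr.rPlus M a + h)) :=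
    isCompact_shell a (by linarith)
  have hmemS : ∀ y ∈ shell a (Kerr.rPlus M a + d₁) (Kerr.rPlus M a + h),
      0 < Kerr.radius a y ∧ Kerr.radius a y ^ 2 - 2 * M * Kerr.radius a y + a ^ 2 ≠ 0 := by
    intro y hy
    refine ⟨by linarith [hy.2.1], ?_⟩
    have := delta_ge ha hd₁.le hy.2.1
    exact (lt_of_lt_of_le (by positivity) this).ne'
  have hcont : ContinuousOn (bulkVec M a) (shell a (Kerr.rPlus M a + d₁) (Kerr.rPlus M a + h)) :=
    fun y hy => (continuousAt_bulkVec M a (hmemS y hy).1 (hmemS y hy).2).continuousWithinAt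
  obtain ⟨U₀, hU₀⟩ := hSc.exists_bound_of_continuousOn hcont
  set U : ℝ := max U₀ 1 with hU_def
  have hU1 : 1 ≤ U := le_max_right _ _
  have hU0 : 0 < U := lt_of_lt_of_le one_pos hU1
  -- the lower bound `η₀` for `2H` on the shell radii
  set η₀ : ℝ := 2 * M * (Kerr.rPlus M a + d₁) / (2 * (Kerr.rPlus M a + h) ^ 2 + a ^ 2) with hη₀_def
  have hη₀ : 0 < η₀ := by rw [hη₀_def]; positivity
  refine ⟨1 / (2 * KΛ ^ 2 * U ^ 4), by positivity, min (1 / (2 * U ^ 2 * h)) (η₀ / (U * h)),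
    lt_min (by positivity) (by positivity), U, fun Φ τ₁ hdev w hwt hwr1 hwr2 => ?_⟩
  have hcs1 : min (1 / (2 * U ^ 2 * h)) (η₀ / (U * h)) ≤ 1 / (2 * U ^ 2 * h) := min_le_left _ _
  have hcs2 : min (1 / (2 * U ^ 2 * h)) (η₀ / (U * h)) ≤ η₀ / (U * h) := min_le_right _ _
  have hcs0 : 0 < min (1 / (2 * U ^ 2 * h)) (η₀ / (U * h)) := lt_min (by positivity) (by positivity)
  set cₛ := min (1 / (2 * U ^ 2 * h)) (η₀ / (U * h)) with hcₛ_def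
  -- rest-frame position
  set q : E4 := poincareInv Λ c w.1 with hq_def
  have hrq : Kerr.radius a q = B.radius w.1 := (hBr w.1).symm
  have hq1 : Kerr.rPlus M a + d₁ ≤ Kerr.radius a q := hrq ▸ hwr1
  have hq2 : Kerr.radius a q ≤ Kerr.rPlus M a + h := hrq ▸ hwr2
  have hq0 : 0 < Kerr.radius a q := by linarith
  have hΔq : 0 < Kerr.radius a q ^ 2 - 2 * M * Kerr.radius a q + a ^ 2 :=
    lt_of_lt_of_le (by positivity) (delta_ge ha hd₁.le hq1)
  have hH0 : 0 ≤ Kerr.scalarH M a q := Kerr.scalarH_nonneg hM.le a q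
  have hSig0 : 0 < Kerr.blSigma a (E4.spatial q) := Kerr.blSigma_spatial_pos hq0
  have h2H : η₀ ≤ 2 * Kerr.scalarH M a q := two_mul_scalarH_ge hM (by linarith) hq1 hq2
  -- the vector `u` and its normalisation `v = u / u⁰`
  set u : E4 := bulkVec M a q with hu_def
  have hu0 : 1 ≤ u 0 := by
    rw [hu_def, bulkVec_apply_zero]
    have : 0 ≤ 4 * Kerr.scalarH M a q * Kerr.blSigma a (E4.spatial q) /
        (Kerr.radius a q ^ 2 - 2 * M * Kerr.radius a q + a ^ 2) * (2 * Kerr.scalarH M a q) := by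
      positivity
    linarith
  have hu0' : 0 < u 0 := by linarith
  have huU : ‖u‖ ≤ U := by
    have hmem : tn q ∈ shell a (Kerr.rPlus M a + d₁) (Kerr.rPlus M a + h) :=
      ⟨tn_apply_zero q, by rw [radius_tn]; exact hq1, by rw [radius_tn]; exact hq2⟩
    have h1 := hU₀ (tn q) hmem
    rw [bulkVec_tn] at h1
    exact h1.trans (le_max_left _ _)
  have hu0U : u 0 ≤ U := (le_abs_self _).trans ((abs_apply_le_norm u 0).trans huU)
  have hguu : Kerr.bilin M a q u u = -1 - 2 * Kerr.scalarH M a q := bulkVec_self hq0 hΔq.ne'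
  have hgWu : Kerr.bilin M a q (Kerr.radiusGradVector M a q) u = 2 * Kerr.scalarH M a q :=
    bilin_radiusGradVector_bulkVec hq0 hΔq.ne'
  set v : E4 := (u 0)⁻¹ • u with hv_def
  have hvn : ‖v‖ ≤ U := by
    rw [hv_def, norm_smul, Real.norm_eq_abs, abs_of_pos (inv_pos.2 hu0')]
    calc (u 0)⁻¹ * ‖u‖ ≤ 1 * ‖u‖ :=
          mul_le_mul_of_nonneg_right (inv_le_one_of_one_le₀ hu0) (norm_nonneg _)
      _ ≤ U := by rw [one_mul]; exact huU
  refine ⟨v, ?_, hvn, ?_, ?_⟩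
  · rw [hv_def, PiLp.smul_apply, smul_eq_mul, inv_mul_cancel₀ hu0'.ne']
  · -- the metric inequality
    have hε0 : (0 : ℝ) ≤ 1 / (2 * KΛ ^ 2 * U ^ 4) := by positivity
    have hdv := (dev_bounds 𝓢 B Φ hε0 hdev w hwt hwr2).1
    have h1 := val_mfderiv_le 𝓢 B Φ w hdv ((Λ : E4 ≃L[ℝ] E4) v) ((Λ : E4 ≃L[ℝ] E4) v)
    have h2 : B.bilin w.1 ((Λ : E4 ≃L[ℝ] E4) v) ((Λ : E4 ≃L[ℝ] E4) v) = Kerr.bilin M a q v v := by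
      rw [hBb, boostedKerrBilin_apply_boost]
    have h3 : Kerr.bilin M a q v v = (u 0)⁻¹ * (u 0)⁻¹ * (-1 - 2 * Kerr.scalarH M a q) := by
      simp only [hv_def, map_smul, smul_apply, smul_eq_mul]
      rw [hguu]
      ring
    have h4 : Kerr.bilin M a q v v ≤ -(1 / U ^ 2) := by
      rw [h3]
      have h5 : 1 / U ^ 2 ≤ (u 0)⁻¹ * (u 0)⁻¹ := by
        rw [← mul_inv, ← one_div]
        exact one_div_le_one_div_of_le (by positivity) (by nlinarith [hu0U, hu0])
      have h6 : (u 0)⁻¹ * (u 0)⁻¹ * (-1 - 2 * Kerr.scalarH M a q) ≤ (u 0)⁻¹ * (u 0)⁻¹ * (-1) :=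
        mul_le_mul_of_nonneg_left (by linarith) (by positivity)
      linarith
    have hΛv : ‖(Λ : E4 ≃L[ℝ] E4) v‖ ≤ KΛ * U := (hΛle v).trans (mul_le_mul_of_nonneg_left hvn (by positivity))
    have h7 : 1 / (2 * KΛ ^ 2 * U ^ 4) * ‖(Λ : E4 ≃L[ℝ] E4) v‖ * ‖(Λ : E4 ≃L[ℝ] E4) v‖ ≤
        1 / (2 * U ^ 2) := by
      have h8 : ‖(Λ : E4 ≃L[ℝ] E4) v‖ * ‖(Λ : E4 ≃L[ℝ] E4) v‖ ≤ (KΛ * U) * (KΛ * U) :=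
        mul_le_mul hΛv hΛv (norm_nonneg _) (by positivity)
      calc 1 / (2 * KΛ ^ 2 * U ^ 4) * ‖(Λ : E4 ≃L[ℝ] E4) v‖ * ‖(Λ : E4 ≃L[ℝ] E4) v‖
          = 1 / (2 * KΛ ^ 2 * U ^ 4) * (‖(Λ : E4 ≃L[ℝ] E4) v‖ * ‖(Λ : E4 ≃L[ℝ] E4) v‖) := by ring
        _ ≤ 1 / (2 * KΛ ^ 2 * U ^ 4) * ((KΛ * U) * (KΛ * U)) :=
          mul_le_mul_of_nonneg_left h8 (by positivity)
        _ = 1 / (2 * U ^ 2) := by field_simp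
    have h9 : cₛ * (B.radius w.1 - Kerr.rPlus M a) ≤ 1 / (2 * U ^ 2) := by
      calc cₛ * (B.radius w.1 - Kerr.rPlus M a) ≤ (1 / (2 * U ^ 2 * h)) * h :=
            mul_le_mul hcs1 (by linarith) (by linarith) (by positivity)
        _ = 1 / (2 * U ^ 2) := by field_simp
    have h10 : (1 : ℝ) / U ^ 2 = 2 * (1 / (2 * U ^ 2)) := by field_simp
    linarith
  · -- the radial slope
    have hdr : Kerr.radiusGrad a (E4.spatial q) (E4.spatial v) = (u 0)⁻¹ * (2 * Kerr.scalarH M a q) := by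
      rw [← Kerr.bilin_radiusGradVector hq0 v, hv_def, map_smul, smul_eq_mul, hgWu]
    rw [hdr]
    have h1 : η₀ / U ≤ (u 0)⁻¹ * (2 * Kerr.scalarH M a q) := by
      rw [div_eq_inv_mul]
      exact mul_le_mul (by rw [inv_le_inv₀ hU0 hu0']; exact hu0U) h2H hη₀.le (by positivity)
    have h2 : cₛ * (B.radius w.1 - Kerr.rPlus M a) ≤ η₀ / U := by
      calc cₛ * (B.radius w.1 - Kerr.rPlus M a) ≤ (η₀ / (U * h)) * h :=
            mul_le_mul hcs2 (by linarith) (by linarith) (by positivity)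
        _ = η₀ / U := by field_simp
    linarith

end Engine

/-! ### §4 The layer `r₊ < r ≤ r₊ + d₁`: transport of the anchored vector along the outgoing null ray -/

section EngineLayer

variable (𝓢 : Spacetime.{0} 4)

/-- **Layer slope** (the red-shift half of (T)).  Near the horizon, `r₊ < r ≤ r₊ + d₁`, the vector is
transported from the anchored one at the foot point `w₀ = w − dΛn` of the outgoing null ray
(`n = (0, ℓ⃗)`, `r(w₀) = r₊`, same `t*`): with `v₁ = v₀/v₀⁰ = K_{q₀} + e` (`K` the Hawking field,
`e⁰ = 0`) one has `|e|² ≤ g_{q₀}(e,e) ≤ g_{q₀}(v₁,v₁) ≤ ε‖Λ‖²‖v₁‖²` (nullity of `K` and tangency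
`g_{q₀}(K, e) = (Σ/(r₊²+a²)) dr(e⃗) ≥ 0` on the horizon, anchoring `Φ^*g(Λv₁,Λv₁) ≤ 0`), so
`|e| ≤ 2‖Λ‖C_K √ε`; the candidate `v = K_q + e + μd·n` then has
`Φ^*g_w(Λv,Λv) ≤ g_q(K,K) + O(√ε + μ + μ²d₁) d ≤ −(c₀/2) d` by the red-shift bound
`g_q(K_q,K_q) ≤ −c₀ d` («KerrHorizonRedShiftLinear»), the `C¹` deviation bound along the segment
`[w₀, w]` and Lipschitz bounds for `g_{M,a}`, `dr` on the compact shell, while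
`dr(v) = dr(e⃗)|_q + μd ≥ μd − L_r C_e √ε d ≥ (μ/2) d`.  DRSR arXiv:1402.7034, §2.2.2, Lemma 4.7.2;
DHRT arXiv:2104.08222, §1. [cite: DafermosRodnianskiShlapentokhrothman2014, Lemma 4.7.2] -/
theorem layer_slope (B : ModelBackground) (Λ : lorentzGroup) (c : E4) {M : ℝ} (a : ℝ) (hM : 0 < M)
    (ha : |a| < M) {h : ℝ} (hh : 0 < h)
    (hBb : B.bilin = boostedKerrBilin Λ c M a) (hBt : ∀ x, B.time x = poincareInv Λ c x 0)
    (hBr : ∀ x, B.radius x = Kerr.radius a (poincareInv Λ c x))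
    (hBd : ∀ z : E4, Kerr.rPlus M a - h < Kerr.radius a (poincareInv Λ c z) → z ∈ (B.domain : Set E4)) :
    ∃ d₁ : ℝ, 0 < d₁ ∧ ∃ ε : ℝ, 0 < ε ∧ ∃ cₛ : ℝ, 0 < cₛ ∧ ∃ K : ℝ,
    ∀ Φ : B.domain → 𝓢.carrier,
      ContMDiff 𝓘(ℝ, E4) (𝓡 4) ((⊤ : ℕ∞) : WithTop ℕ∞) Φ →
    ∀ τ₁ : ℝ,
    (∀ τ : ℝ, τ₁ ≤ τ → 𝓢.truncDeviationCk B Φ 1 (Kerr.rPlus M a + h) τ ≤ ENNReal.ofReal ε) →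
    (∀ w : B.domain, τ₁ ≤ B.time w.1 → B.radius w.1 = Kerr.rPlus M a →
      ∃ v : E4, 0 < v 0 ∧
        𝓢.metric.val (Φ w) (mfderiv 𝓘(ℝ, E4) (𝓡 4) Φ w ((Λ : E4 ≃L[ℝ] E4) v))
          (mfderiv 𝓘(ℝ, E4) (𝓡 4) Φ w ((Λ : E4 ≃L[ℝ] E4) v)) ≤ 0 ∧
        0 ≤ Kerr.radiusGrad a (E4.spatial (poincareInv Λ c w.1)) (E4.spatial v)) →
    ∀ w : B.domain, τ₁ ≤ B.time w.1 → Kerr.rPlus M a < B.radius w.1 →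
      B.radius w.1 ≤ Kerr.rPlus M a + d₁ →
      ∃ v : E4, v 0 = 1 ∧ ‖v‖ ≤ K ∧
        𝓢.metric.val (Φ w) (mfderiv 𝓘(ℝ, E4) (𝓡 4) Φ w ((Λ : E4 ≃L[ℝ] E4) v))
          (mfderiv 𝓘(ℝ, E4) (𝓡 4) Φ w ((Λ : E4 ≃L[ℝ] E4) v)) ≤
          -(cₛ * (B.radius w.1 - Kerr.rPlus M a)) ∧
        cₛ * (B.radius w.1 - Kerr.rPlus M a) ≤
          Kerr.radiusGrad a (E4.spatial (poincareInv Λ c w.1)) (E4.spatial v) := by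
  have hMa : Kerr.IsSubextremal M a := ha
  have hale : |a| ≤ M := ha.le
  have hrpM : M ≤ Kerr.rPlus M a := le_rPlus M a
  have hrp : 0 < Kerr.rPlus M a := hM.trans_le hrpM
  -- the Lorentz part of the motion
  obtain ⟨KΛ, hKΛ_def⟩ : ∃ K : ℝ, ‖((Λ : E4 ≃L[ℝ] E4) : E4 →L[ℝ] E4)‖ = K := ⟨_, rfl⟩
  have hKΛ : 1 ≤ KΛ := hKΛ_def ▸ BoostedKerrLegs.one_le_norm_lorentz Λ
  have hKΛ0 : 0 < KΛ := by linarith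
  have hΛle : ∀ v : E4, ‖(Λ : E4 ≃L[ℝ] E4) v‖ ≤ KΛ * ‖v‖ := fun v =>
    hKΛ_def ▸ ((Λ : E4 ≃L[ℝ] E4) : E4 →L[ℝ] E4).le_opNorm v
  -- (1) the horizon red-shift «KerrHorizonRedShiftLinear»
  obtain ⟨d₀, hd₀, c₀, hc₀, hKK⟩ := bilin_hawkingVector_self_le_linear (M := M) (a := a) hMa
  -- (2) the compact shell `r₊ ≤ r ≤ r₊ + h` and the constants `C_G`, `L_g`, `L_r`
  have hSc : IsCompact (shell a (Kerr.rPlus M a) (Kerr.rPlus M a + h)) := isCompact_shell a (by linarith)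
  have hSpos : ∀ y ∈ shell a (Kerr.rPlus M a) (Kerr.rPlus M a + h), 0 < Kerr.radius a y :=
    fun y hy => hrp.trans_le hy.2.1
  obtain ⟨CG₀, hCG₀⟩ := hSc.exists_bound_of_continuousOn (f := Kerr.bilin M a)
    (fun y hy => (continuousAt_bilin M a (hSpos y hy)).continuousWithinAt)
  obtain ⟨CG, hCGdef⟩ : ∃ C : ℝ, max CG₀ 1 = C := ⟨_, rfl⟩
  have hCG1 : 1 ≤ CG := hCGdef ▸ le_max_right _ _
  have hCG0 : 0 < CG := by linarith
  have hCG : ∀ y : E4, Kerr.rPlus M a ≤ Kerr.radius a y → Kerr.radius a y ≤ Kerr.rPlus M a + h →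
      ‖Kerr.bilin M a y‖ ≤ CG := by
    intro y h1 h2
    have hmem : tn y ∈ shell a (Kerr.rPlus M a) (Kerr.rPlus M a + h) :=
      ⟨tn_apply_zero y, by rw [radius_tn]; exact h1, by rw [radius_tn]; exact h2⟩
    have h3 := hCG₀ (tn y) hmem
    rw [bilin_tn] at h3
    exact h3.trans (hCGdef ▸ le_max_left _ _)
  obtain ⟨Lg, hLg0, hLg⟩ := exists_lipschitz_of_contDiffAt hSc (f := Kerr.bilin M a)
    (fun y hy => Kerr.contDiffAt_bilin M a (hSpos y hy))
  obtain ⟨Lr, hLr0, hLr⟩ := exists_lipschitz_of_contDiffAt hSc (f := fderiv ℝ (Kerr.radius a))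
    (fun y hy => contDiffAt_fderiv_radius (hSpos y hy))
  -- (3) the size of the Hawking field on the collar
  obtain ⟨om, homdef⟩ : ∃ om : ℝ, Kerr.horizonAngularVelocity M a = om := ⟨_, rfl⟩
  obtain ⟨CK, hCKdef⟩ : ∃ C : ℝ, 1 + |om| * (Kerr.rPlus M a + h + |a|) = C := ⟨_, rfl⟩
  have hCK1 : 1 ≤ CK := by
    rw [← hCKdef]
    have : 0 ≤ |om| * (Kerr.rPlus M a + h + |a|) := by positivity
    linarith
  have hCK0 : 0 < CK := by linarith
  have hCK : ∀ y : E4, 0 < Kerr.radius a y → Kerr.radius a y ≤ Kerr.rPlus M a + h →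
      ‖Kerr.hawkingVector M a y‖ ≤ CK := by
    intro y h0 h2
    have h3 := norm_hawkingVector_le M a h0
    rw [homdef] at h3
    rw [← hCKdef]
    refine h3.trans ?_
    have h4 : Kerr.radius a y + |a| ≤ Kerr.rPlus M a + h + |a| := by linarith
    linarith [mul_le_mul_of_nonneg_left h4 (abs_nonneg om)]
  -- (4) the remaining constants
  obtain ⟨μ, hμdef⟩ : ∃ μ : ℝ, c₀ / (8 * CG * CK) = μ := ⟨_, rfl⟩
  have hμ0 : 0 < μ := by rw [← hμdef]; positivity
  have hμ1 : 2 * μ * CG * CK = c₀ / 4 := by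
    have : μ * (8 * CG * CK) = c₀ := by rw [← hμdef]; exact div_mul_cancel₀ _ (by positivity)
    linarith
  obtain ⟨Ce, hCedef⟩ : ∃ C : ℝ, 2 * KΛ * CK = C := ⟨_, rfl⟩
  have hCe0 : 0 < Ce := by rw [← hCedef]; positivity
  obtain ⟨Kv, hKvdef⟩ : ∃ C : ℝ, CK + Ce + μ * h = C := ⟨_, rfl⟩
  have hKvCK : CK + Ce ≤ Kv := by
    rw [← hKvdef]
    have : 0 ≤ μ * h := by positivity
    linarith
  have hKv0 : 0 < Kv := by linarith
  obtain ⟨C4, hC4def⟩ : ∃ C : ℝ, KΛ ^ 3 * Kv ^ 2 + 2 * KΛ ^ 2 * (|om| + μ) * Kv = C := ⟨_, rfl⟩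
  have hC40 : 0 < C4 := by rw [← hC4def]; positivity
  obtain ⟨Cη, hCηdef⟩ : ∃ C : ℝ,
      2 * (Lg * CK + CG * |om|) * Ce + Lg * Ce ^ 2 + 2 * μ * CG * Ce + C4 = C := ⟨_, rfl⟩
  have hCη0 : 0 < Cη := by rw [← hCηdef]; positivity
  obtain ⟨η, hηdef⟩ : ∃ e : ℝ,
      min (min 1 (1 / (2 * KΛ))) (min (c₀ / (8 * Cη)) (μ / (2 * (Lr * Ce + 1)))) = e := ⟨_, rfl⟩
  have hη0 : 0 < η := by
    rw [← hηdef]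
    exact lt_min (lt_min one_pos (by positivity)) (lt_min (by positivity) (by positivity))
  have hη1 : η ≤ 1 := by rw [← hηdef]; exact (min_le_left _ _).trans (min_le_left _ _)
  have hη2 : η ≤ 1 / (2 * KΛ) := by rw [← hηdef]; exact (min_le_left _ _).trans (min_le_right _ _)
  have hη3 : η ≤ c₀ / (8 * Cη) := by rw [← hηdef]; exact (min_le_right _ _).trans (min_le_left _ _)
  have hη4 : η ≤ μ / (2 * (Lr * Ce + 1)) := by
    rw [← hηdef]; exact (min_le_right _ _).trans (min_le_right _ _)
  have hηKΛ : η * KΛ ≤ 1 / 2 := by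
    calc η * KΛ ≤ 1 / (2 * KΛ) * KΛ := mul_le_mul_of_nonneg_right hη2 hKΛ0.le
      _ = 1 / 2 := by field_simp
  have hηCη : Cη * η ≤ c₀ / 8 := by
    have := (le_div_iff₀ (by positivity : (0 : ℝ) < 8 * Cη)).1 hη3
    linarith
  have hηLr : Lr * Ce * η ≤ μ / 2 := by
    have h1 := (le_div_iff₀ (by positivity : (0 : ℝ) < 2 * (Lr * Ce + 1))).1 hη4
    have h2 : (Lr * Ce + 1) * η = Lr * Ce * η + η := by ring
    linarith
  obtain ⟨ε, hεdef⟩ : ∃ e : ℝ, η ^ 2 = e := ⟨_, rfl⟩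
  have hε0 : 0 < ε := by rw [← hεdef]; positivity
  have hεη : ε ≤ η := by rw [← hεdef]; exact pow_le_of_le_one hη0.le hη1 two_ne_zero
  obtain ⟨d₁, hd₁def⟩ : ∃ d : ℝ, min (min d₀ h) (c₀ / (8 * μ ^ 2 * CG)) = d := ⟨_, rfl⟩
  have hd₁0 : 0 < d₁ := by rw [← hd₁def]; exact lt_min (lt_min hd₀ hh) (by positivity)
  have hd₁d₀ : d₁ ≤ d₀ := by rw [← hd₁def]; exact (min_le_left _ _).trans (min_le_left _ _)
  have hd₁h : d₁ ≤ h := by rw [← hd₁def]; exact (min_le_left _ _).trans (min_le_right _ _)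
  have hd₁c : μ ^ 2 * CG * d₁ ≤ c₀ / 8 := by
    have h1 : d₁ ≤ c₀ / (8 * μ ^ 2 * CG) := by rw [← hd₁def]; exact min_le_right _ _
    have := (le_div_iff₀ (by positivity : (0 : ℝ) < 8 * μ ^ 2 * CG)).1 h1
    linarith
  obtain ⟨cₛ, hcₛdef⟩ : ∃ s : ℝ, min (c₀ / 2) (μ / 2) = s := ⟨_, rfl⟩
  have hcₛ0 : 0 < cₛ := by rw [← hcₛdef]; exact lt_min (by positivity) (by positivity)
  have hcₛ1 : cₛ ≤ c₀ / 2 := by rw [← hcₛdef]; exact min_le_left _ _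
  have hcₛ2 : cₛ ≤ μ / 2 := by rw [← hcₛdef]; exact min_le_right _ _
  refine ⟨d₁, hd₁0, ε, hε0, cₛ, hcₛ0, Kv, fun Φ hΦ τ₁ hdev hanchor w hwt hwr1 hwr2 => ?_⟩
  /- ───── rest-frame bookkeeping ───── -/
  have hrest : ∀ (x v : E4) (θ : ℝ), poincareInv Λ c (x + θ • (Λ : E4 ≃L[ℝ] E4) v) =
      poincareInv Λ c x + θ • v := fun x v θ => poincareInv_add_smul Λ c x v θ
  have hsmooth : ∀ x : E4, 0 < Kerr.radius a (poincareInv Λ c x) →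
      ContDiffAt ℝ ((⊤ : ℕ∞) : WithTop ℕ∞) B.bilin x := fun x hx => by
    rw [hBb]; exact contDiffAt_boostedKerrBilin Λ c M a hx
  have hdv : ∀ x : B.domain, τ₁ ≤ B.time x.1 → B.radius x.1 ≤ Kerr.rPlus M a + h →
      ‖𝓢.deviation B Φ x‖ ≤ ε ∧ ‖fderiv ℝ (𝓢.deviationExtend B Φ) x.1‖ ≤ ε :=
    fun x hx0 hx1 => dev_bounds 𝓢 B Φ hε0.le hdev x hx0 hx1
  obtain ⟨q, hqdef⟩ : ∃ q : E4, poincareInv Λ c w.1 = q := ⟨_, rfl⟩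
  have hrq : B.radius w.1 = Kerr.radius a q := by rw [hBr, hqdef]
  have htq : B.time w.1 = q 0 := by rw [hBt, hqdef]
  obtain ⟨d, hddef⟩ : ∃ d : ℝ, Kerr.radius a q - Kerr.rPlus M a = d := ⟨_, rfl⟩
  have hqr : Kerr.radius a q = Kerr.rPlus M a + d := by linarith only [hddef]
  have hd0 : 0 < d := by have := hwr1; rw [hrq] at this; linarith only [this, hddef]
  have hdd₁ : d ≤ d₁ := by have := hwr2; rw [hrq] at this; linarith only [this, hddef]
  have hdh : d ≤ h := hdd₁.trans hd₁h
  have hdd₀ : d ≤ d₀ := hdd₁.trans hd₁d₀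
  have hq0 : 0 < Kerr.radius a q := by linarith only [hqr, hd0, hrp]
  have hrad_w : B.radius w.1 - Kerr.rPlus M a = d := by rw [hrq, hddef]
  obtain ⟨n, hn_def⟩ : ∃ n' : E4, n' = nvec a q := ⟨_, rfl⟩
  have hn1 : ‖n‖ = 1 := by rw [hn_def]; exact norm_nvec hq0
  have hn0 : n 0 = 0 := by rw [hn_def]; exact nvec_apply_zero a q
  have hΛn : ‖(Λ : E4 ≃L[ℝ] E4) n‖ ≤ KΛ := by simpa [hn1] using hΛle n
  have hray : ∀ s : ℝ, -d ≤ s → Kerr.radius a (q + s • n) = Kerr.radius a q + s :=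
    fun s hs => by rw [hn_def]; exact radius_add_smul_nvec hq0 (by linarith only [hs, hqr, hd0, hrp])
  have hray0 : ∀ s : ℝ, (q + s • n) 0 = q 0 := fun s => by
    rw [hn_def]; exact add_smul_nvec_apply_zero a q s
  -- the foot point `q₀ = q − d n` on the horizon, same `t*`
  obtain ⟨q₀, hq₀_def⟩ : ∃ q' : E4, q' = q + (-d) • n := ⟨_, rfl⟩
  have hq₀r : Kerr.radius a q₀ = Kerr.rPlus M a := by
    rw [hq₀_def, hray (-d) le_rfl]; linarith only [hqr]
  have hq₀0 : 0 < Kerr.radius a q₀ := by rw [hq₀r]; exact hrp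
  have hq₀t : q₀ 0 = q 0 := by rw [hq₀_def]; exact hray0 (-d)
  -- the lab segment from the lab foot point `p` to `w`
  obtain ⟨p, hp_def⟩ : ∃ p' : E4, p' = w.1 + (-d) • (Λ : E4 ≃L[ℝ] E4) n := ⟨_, rfl⟩
  have hpinv : poincareInv Λ c p = q₀ := by rw [hp_def, hrest, hqdef, hq₀_def]
  have hseg_inv : ∀ θ : ℝ, poincareInv Λ c (p + θ • (Λ : E4 ≃L[ℝ] E4) n) = q + (-d + θ) • n := by
    intro θ; rw [hrest, hpinv, hq₀_def, add_assoc, ← add_smul]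
  have hseg_r : ∀ θ : ℝ, 0 ≤ θ →
      Kerr.radius a (poincareInv Λ c (p + θ • (Λ : E4 ≃L[ℝ] E4) n)) = Kerr.rPlus M a + θ := by
    intro θ hθ; rw [hseg_inv, hray _ (by linarith only [hθ])]; linarith only [hqr]
  have hseg_t : ∀ θ : ℝ, B.time (p + θ • (Λ : E4 ≃L[ℝ] E4) n) = q 0 := by
    intro θ; rw [hBt, hseg_inv, hray0]
  have hdom : ∀ θ ∈ Icc (0 : ℝ) d, p + θ • (Λ : E4 ≃L[ℝ] E4) n ∈ (B.domain : Set E4) := by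
    intro θ hθ; apply hBd; rw [hseg_r θ hθ.1]; linarith only [hθ.1, hh]
  have hpdom : p ∈ (B.domain : Set E4) := by
    have := hdom 0 ⟨le_rfl, hd0.le⟩; rwa [zero_smul, add_zero] at this
  obtain ⟨w₀, hw₀_def⟩ : ∃ w' : B.domain, w' = ⟨p, hpdom⟩ := ⟨_, rfl⟩
  have hw₀1 : w₀.1 = p := by rw [hw₀_def]
  have hp0 : B.time p = q 0 := by have := hseg_t 0; rwa [zero_smul, add_zero] at this
  have hw₀t : τ₁ ≤ B.time w₀.1 := by rw [hw₀1, hp0, ← htq]; exact hwt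
  have hw₀r : B.radius w₀.1 = Kerr.rPlus M a := by rw [hw₀1, hBr, hpinv, hq₀r]
  have hpw : p + d • (Λ : E4 ≃L[ℝ] E4) n = w.1 := by
    rw [hp_def, add_assoc, ← add_smul, neg_add_cancel, zero_smul, add_zero]
  -- the deviation is `ε`-Lipschitz along the segment
  have hlip := deviation_segment_lipschitz 𝓢 B Φ hΦ p ((Λ : E4 ≃L[ℝ] E4) n) (ℓ := d) (ε := ε) hdom
    (fun θ hθ => hsmooth _ (by rw [hseg_r θ hθ.1]; linarith only [hθ.1, hrp]))
    (fun θ hθ => (hdv ⟨p + θ • (Λ : E4 ≃L[ℝ] E4) n, hdom θ hθ⟩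
      (by show τ₁ ≤ B.time (p + θ • (Λ : E4 ≃L[ℝ] E4) n); rw [hseg_t, ← htq]; exact hwt)
      (by show B.radius (p + θ • (Λ : E4 ≃L[ℝ] E4) n) ≤ _; rw [hBr, hseg_r θ hθ.1]
          linarith only [hθ.2, hdh])).2)
  have hDdiff : ‖𝓢.deviation B Φ w - 𝓢.deviation B Φ w₀‖ ≤ ε * KΛ * d := by
    have h1 := hlip d ⟨hd0.le, le_rfl⟩
    rw [hpw] at h1
    rw [← 𝓢.deviationExtend_coe B Φ w, ← 𝓢.deviationExtend_coe B Φ w₀, hw₀1]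
    have : ε * ‖(Λ : E4 ≃L[ℝ] E4) n‖ ≤ ε * KΛ := mul_le_mul_of_nonneg_left hΛn hε0.le
    exact h1.trans (mul_le_mul_of_nonneg_right this hd0.le)
  have hDw₀ : ‖𝓢.deviation B Φ w₀‖ ≤ ε := (hdv w₀ hw₀t (by rw [hw₀r]; linarith only [hh])).1
  /- ───── the pulled-back metric in the boosted frame: `Φ^*g(ΛX, ΛY) = D(ΛX, ΛY) + g_{M,a}(X, Y)` ───── -/
  have hBq₀ : ∀ X Y : E4, B.bilin w₀.1 ((Λ : E4 ≃L[ℝ] E4) X) ((Λ : E4 ≃L[ℝ] E4) Y) =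
      Kerr.bilin M a q₀ X Y := by
    intro X Y; rw [hw₀1, hBb, boostedKerrBilin_apply_boost, hpinv]
  have hBq : ∀ X Y : E4, B.bilin w.1 ((Λ : E4 ≃L[ℝ] E4) X) ((Λ : E4 ≃L[ℝ] E4) Y) =
      Kerr.bilin M a q X Y := by
    intro X Y; rw [hBb, boostedKerrBilin_apply_boost, hqdef]
  have hval₀ : ∀ X Y : E4,
      𝓢.metric.val (Φ w₀) (mfderiv 𝓘(ℝ, E4) (𝓡 4) Φ w₀ ((Λ : E4 ≃L[ℝ] E4) X))
        (mfderiv 𝓘(ℝ, E4) (𝓡 4) Φ w₀ ((Λ : E4 ≃L[ℝ] E4) Y)) =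
      𝓢.deviation B Φ w₀ ((Λ : E4 ≃L[ℝ] E4) X) ((Λ : E4 ≃L[ℝ] E4) Y) + Kerr.bilin M a q₀ X Y := by
    intro X Y; rw [𝓢.deviation_apply, hBq₀]; ring
  have hval : ∀ X Y : E4,
      𝓢.metric.val (Φ w) (mfderiv 𝓘(ℝ, E4) (𝓡 4) Φ w ((Λ : E4 ≃L[ℝ] E4) X))
        (mfderiv 𝓘(ℝ, E4) (𝓡 4) Φ w ((Λ : E4 ≃L[ℝ] E4) Y)) =
      𝓢.deviation B Φ w ((Λ : E4 ≃L[ℝ] E4) X) ((Λ : E4 ≃L[ℝ] E4) Y) + Kerr.bilin M a q X Y := by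
    intro X Y; rw [𝓢.deviation_apply, hBq]; ring
  /- ───── the anchored vector at the foot point, normalised: `v₁ = K₀ + e` ───── -/
  obtain ⟨v₀, hv₀0, hv₀g, hv₀r⟩ := hanchor w₀ hw₀t hw₀r
  rw [hval₀] at hv₀g
  have hv₀r' : 0 ≤ Kerr.radiusGrad a (E4.spatial q₀) (E4.spatial v₀) := by
    rw [← hpinv, ← hw₀1]; exact hv₀r
  obtain ⟨c₁, hc₁def⟩ : ∃ s : ℝ, (v₀ 0)⁻¹ = s := ⟨_, rfl⟩
  have hc₁ : 0 < c₁ := by rw [← hc₁def]; exact inv_pos.2 hv₀0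
  obtain ⟨v₁, hv₁_def⟩ : ∃ v' : E4, v' = c₁ • v₀ := ⟨_, rfl⟩
  have hv₁0 : v₁ 0 = 1 := by
    rw [hv₁_def, PiLp.smul_apply, smul_eq_mul, ← hc₁def]; exact inv_mul_cancel₀ hv₀0.ne'
  have hv₁g : 𝓢.deviation B Φ w₀ ((Λ : E4 ≃L[ℝ] E4) v₁) ((Λ : E4 ≃L[ℝ] E4) v₁) +
      Kerr.bilin M a q₀ v₁ v₁ ≤ 0 := by
    have : 𝓢.deviation B Φ w₀ ((Λ : E4 ≃L[ℝ] E4) v₁) ((Λ : E4 ≃L[ℝ] E4) v₁) +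
        Kerr.bilin M a q₀ v₁ v₁ =
        c₁ * (c₁ * (𝓢.deviation B Φ w₀ ((Λ : E4 ≃L[ℝ] E4) v₀) ((Λ : E4 ≃L[ℝ] E4) v₀) +
          Kerr.bilin M a q₀ v₀ v₀)) := by
      simp only [hv₁_def, map_smul, smul_apply, smul_eq_mul]; ring
    rw [this]; exact mul_nonpos_iff.2 (Or.inl ⟨hc₁.le, mul_nonpos_iff.2 (Or.inl ⟨hc₁.le, hv₀g⟩)⟩)
  have hv₁r : 0 ≤ Kerr.radiusGrad a (E4.spatial q₀) (E4.spatial v₁) := by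
    rw [hv₁_def, map_smul, map_smul, smul_eq_mul]; exact mul_nonneg hc₁.le hv₀r'
  obtain ⟨K₀, hK₀_def⟩ : ∃ K' : E4, K' = Kerr.hawkingVector M a q₀ := ⟨_, rfl⟩
  obtain ⟨Kq, hKq_def⟩ : ∃ K' : E4, K' = Kerr.hawkingVector M a q := ⟨_, rfl⟩
  obtain ⟨e, he_def⟩ : ∃ e' : E4, e' = v₁ - K₀ := ⟨_, rfl⟩
  have he0 : e 0 = 0 := by rw [he_def, PiLp.sub_apply, hv₁0, hK₀_def, hawkingVector_apply_zero, sub_self]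
  have hv₁e : v₁ = K₀ + e := by rw [he_def, add_sub_cancel]
  have hK₀n : ‖K₀‖ ≤ CK := by rw [hK₀_def]; exact hCK q₀ hq₀0 (by rw [hq₀r]; linarith only [hh])
  have hKqn : ‖Kq‖ ≤ CK := by rw [hKq_def]; exact hCK q hq0 (by linarith only [hqr, hdh])
  -- Kerr identities at the foot point: `g(K₀, K₀) = 0`, `g(K₀, e) ≥ 0`, coercivity on `e`
  have hKK0 : Kerr.bilin M a q₀ K₀ K₀ = 0 := by
    rw [hK₀_def]; exact bilin_hawkingVector_self_of_radius_eq hale hM hq₀r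
  have hdre0 : 0 ≤ Kerr.radiusGrad a (E4.spatial q₀) (E4.spatial e) := by
    have : Kerr.radiusGrad a (E4.spatial q₀) (E4.spatial e) =
        Kerr.radiusGrad a (E4.spatial q₀) (E4.spatial v₁) -
          Kerr.radiusGrad a (E4.spatial q₀) (E4.spatial (Kerr.hawkingVector M a q₀)) := by
      rw [he_def, hK₀_def, map_sub, map_sub]
    rw [this, radiusGrad_spatial_hawkingVector, sub_zero]; exact hv₁r
  have hK0e : 0 ≤ Kerr.bilin M a q₀ K₀ e := by
    rw [hK₀_def, bilin_hawkingVector_of_radius_eq hale hM hq₀r e he0]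
    exact mul_nonneg (div_nonneg (Kerr.blSigma_spatial_pos hq₀0).le
      (add_nonneg (sq_nonneg _) (sq_nonneg _))) hdre0
  have hee : ‖e‖ ^ 2 ≤ Kerr.bilin M a q₀ e e := by
    have := kerr_self_ge (a := a) hM.le q₀ e; rw [he0] at this; simpa using this
  have hGv₁ : Kerr.bilin M a q₀ v₁ v₁ =
      Kerr.bilin M a q₀ K₀ K₀ + 2 * Kerr.bilin M a q₀ K₀ e + Kerr.bilin M a q₀ e e := by
    rw [hv₁e]; exact kerr_expand2 M a q₀ K₀ e
  -- the anchoring inequality transported to the Kerr form: `g_{q₀}(v₁, v₁) ≤ ε ‖Λv₁‖²`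
  have hGv₁le : Kerr.bilin M a q₀ v₁ v₁ ≤
      ε * ‖(Λ : E4 ≃L[ℝ] E4) v₁‖ * ‖(Λ : E4 ≃L[ℝ] E4) v₁‖ := by
    have h2 := (abs_le.1 (abs_apply₂_le (𝓢.deviation B Φ w₀) ((Λ : E4 ≃L[ℝ] E4) v₁)
      ((Λ : E4 ≃L[ℝ] E4) v₁))).1
    have h3 : ‖𝓢.deviation B Φ w₀‖ * ‖(Λ : E4 ≃L[ℝ] E4) v₁‖ * ‖(Λ : E4 ≃L[ℝ] E4) v₁‖ ≤
        ε * ‖(Λ : E4 ≃L[ℝ] E4) v₁‖ * ‖(Λ : E4 ≃L[ℝ] E4) v₁‖ :=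
      mul_le_mul_of_nonneg_right (mul_le_mul_of_nonneg_right hDw₀ (norm_nonneg _)) (norm_nonneg _)
    linarith only [hv₁g, h2, h3]
  -- `|e| ≤ C_e η`
  have hv₁n' : ‖v₁‖ ≤ CK + ‖e‖ := by
    rw [hv₁e]; exact norm_add_le_of_le hK₀n le_rfl
  have heCe : ‖e‖ ≤ Ce * η := by
    have h2 : ‖(Λ : E4 ≃L[ℝ] E4) v₁‖ ≤ KΛ * (CK + ‖e‖) :=
      (hΛle v₁).trans (mul_le_mul_of_nonneg_left hv₁n' hKΛ0.le)
    have h3 : ‖e‖ ^ 2 ≤ (η * KΛ * (CK + ‖e‖)) ^ 2 :=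
      calc ‖e‖ ^ 2 ≤ Kerr.bilin M a q₀ e e := hee
        _ ≤ Kerr.bilin M a q₀ v₁ v₁ := by rw [hGv₁, hKK0]; linarith only [hK0e]
        _ ≤ ε * ‖(Λ : E4 ≃L[ℝ] E4) v₁‖ * ‖(Λ : E4 ≃L[ℝ] E4) v₁‖ := hGv₁le
        _ ≤ ε * (KΛ * (CK + ‖e‖)) * (KΛ * (CK + ‖e‖)) := by
          rw [mul_assoc, mul_assoc]
          exact mul_le_mul_of_nonneg_left (mul_le_mul h2 h2 (norm_nonneg _)
            (mul_nonneg hKΛ0.le (add_nonneg hCK0.le (norm_nonneg _)))) hε0.le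
        _ = (η * KΛ * (CK + ‖e‖)) ^ 2 := by rw [← hεdef]; ring
    have h4 := le_of_sq_le_absorb (norm_nonneg e) (mul_nonneg hη0.le hKΛ0.le) hηKΛ hCK0.le h3
    calc ‖e‖ ≤ 2 * (η * KΛ) * CK := h4
      _ = Ce * η := by rw [← hCedef]; ring
  have heCe1 : ‖e‖ ≤ Ce := heCe.trans (mul_le_of_le_one_right hCe0.le hη1)
  have hv₁n : ‖v₁‖ ≤ Kv := by linarith only [hv₁n', heCe1, hKvCK]
  /- ───── the candidate `v = K_q + e + μ d · n` ───── -/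
  have hμd0 : 0 ≤ μ * d := mul_nonneg hμ0.le hd0.le
  obtain ⟨v, hv_def⟩ : ∃ v' : E4, v' = Kq + e + (μ * d) • n := ⟨_, rfl⟩
  have hv0 : v 0 = 1 := by
    rw [hv_def, PiLp.add_apply, PiLp.add_apply, PiLp.smul_apply, hKq_def, hawkingVector_apply_zero,
      he0, hn0, smul_eq_mul, mul_zero, add_zero, add_zero]
  have hvn : ‖v‖ ≤ Kv := by
    have h1 : ‖(μ * d) • n‖ = μ * d := by rw [norm_smul, hn1, mul_one, Real.norm_eq_abs, abs_of_nonneg hμd0]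
    have h2 : ‖v‖ ≤ ‖Kq‖ + ‖e‖ + ‖(μ * d) • n‖ := by rw [hv_def]; exact norm_add₃_le
    have h3 : μ * d ≤ μ * h := mul_le_mul_of_nonneg_left hdh hμ0.le
    linarith only [h1, h2, h3, hKqn, heCe1, hKvdef]
  have hvΛ : ‖(Λ : E4 ≃L[ℝ] E4) v‖ ≤ KΛ * Kv := (hΛle v).trans (mul_le_mul_of_nonneg_left hvn hKΛ0.le)
  have hv₁Λ : ‖(Λ : E4 ≃L[ℝ] E4) v₁‖ ≤ KΛ * Kv :=
    (hΛle v₁).trans (mul_le_mul_of_nonneg_left hv₁n hKΛ0.le)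
  have hδ : ‖v - v₁‖ ≤ (|om| + μ) * d := by
    have h1 : v - v₁ = (Kq - K₀) + (μ * d) • n := by rw [hv_def, hv₁e]; abel
    have h2 : ‖Kq - K₀‖ ≤ |om| * d := by
      rw [hKq_def, hK₀_def, hq₀_def, hn_def]
      have := norm_hawkingVector_sub_foot M a hq0 hd0.le; rwa [homdef] at this
    have h3 : ‖(μ * d) • n‖ = μ * d := by rw [norm_smul, hn1, mul_one, Real.norm_eq_abs, abs_of_nonneg hμd0]
    rw [h1]; refine (norm_add_le _ _).trans ?_; rw [h3]; linarith only [h2]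
  have hδΛ : ‖(Λ : E4 ≃L[ℝ] E4) (v - v₁)‖ ≤ KΛ * ((|om| + μ) * d) :=
    (hΛle _).trans (mul_le_mul_of_nonneg_left hδ hKΛ0.le)
  /- ───── (A) the Kerr part at `q` ───── -/
  have hexp : Kerr.bilin M a q v v =
      Kerr.bilin M a q Kq Kq + 2 * Kerr.bilin M a q Kq e + Kerr.bilin M a q e e +
      μ * d * (2 * Kerr.bilin M a q Kq n + 2 * Kerr.bilin M a q e n) +
      (μ * d) ^ 2 * Kerr.bilin M a q n n := by
    rw [hv_def]; exact kerr_expand3 M a q Kq e n (μ * d)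
  -- (T1) the red shift `g_q(K_q, K_q) ≤ −c₀ d`
  have hT1 : Kerr.bilin M a q Kq Kq ≤ -(c₀ * d) := by
    have := hKK q (by linarith only [hqr, hd0]) (by linarith only [hqr, hdd₀])
    rw [hddef] at this; rw [hKq_def]; exact this
  -- Lipschitz differences between `q` and `q₀` (segment of length `d` inside the shell)
  have hsegS : segment ℝ (tn q₀) (tn q) ⊆ shell a (Kerr.rPlus M a) (Kerr.rPlus M a + h) := by
    rw [hq₀_def, hn_def]; exact segment_ray_subset_shell hrp hqr hd0.le (by linarith only [hdh])
  have hdist : ‖tn q - tn q₀‖ = d := by rw [hq₀_def, hn_def]; exact norm_tn_sub_tn_foot hq0 hd0.le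
  have hGlip : ‖Kerr.bilin M a q - Kerr.bilin M a q₀‖ ≤ Lg * d := by
    have := hLg (tn q₀) (tn q) hsegS; rwa [bilin_tn, bilin_tn, hdist] at this
  have hRlip : ‖fderiv ℝ (Kerr.radius a) q - fderiv ℝ (Kerr.radius a) q₀‖ ≤ Lr * d := by
    have := hLr (tn q₀) (tn q) hsegS
    rwa [fderiv_radius_tn hq0, fderiv_radius_tn hq₀0, hdist] at this
  have hGq : ‖Kerr.bilin M a q‖ ≤ CG :=
    hCG q (by linarith only [hqr, hd0]) (by linarith only [hqr, hdh])
  have hGq₀ : ‖Kerr.bilin M a q₀‖ ≤ CG := hCG q₀ (by rw [hq₀r]) (by rw [hq₀r]; linarith only [hh])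
  -- (T2) `g_q(K_q, e) − g_{q₀}(K₀, e) ≤ (L_g C_K + C_G|ω|) d |e|`
  have hT2 : Kerr.bilin M a q Kq e - Kerr.bilin M a q₀ K₀ e ≤ (Lg * CK + CG * |om|) * d * ‖e‖ := by
    have h1 : Kerr.bilin M a q Kq e - Kerr.bilin M a q₀ K₀ e =
        (Kerr.bilin M a q - Kerr.bilin M a q₀) Kq e + Kerr.bilin M a q₀ (Kq - K₀) e := by
      simp only [sub_apply, map_sub]; ring
    have h2 := (abs_le.1 (abs_apply₂_le (Kerr.bilin M a q - Kerr.bilin M a q₀) Kq e)).2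
    have h3 := (abs_le.1 (abs_apply₂_le (Kerr.bilin M a q₀) (Kq - K₀) e)).2
    have h4 : ‖Kerr.bilin M a q - Kerr.bilin M a q₀‖ * ‖Kq‖ * ‖e‖ ≤ Lg * d * CK * ‖e‖ :=
      mul_le_mul_of_nonneg_right (mul_le_mul hGlip hKqn (norm_nonneg _) (mul_nonneg hLg0 hd0.le))
        (norm_nonneg _)
    have h5 : ‖Kq - K₀‖ ≤ |om| * d := by
      rw [hKq_def, hK₀_def, hq₀_def, hn_def]
      have := norm_hawkingVector_sub_foot M a hq0 hd0.le; rwa [homdef] at this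
    have h6 : ‖Kerr.bilin M a q₀‖ * ‖Kq - K₀‖ * ‖e‖ ≤ CG * (|om| * d) * ‖e‖ :=
      mul_le_mul_of_nonneg_right (mul_le_mul hGq₀ h5 (norm_nonneg _) hCG0.le) (norm_nonneg _)
    rw [h1]; linarith only [h2, h3, h4, h6]
  -- (T3) `g_q(e, e) − g_{q₀}(e, e) ≤ L_g d |e|²`
  have hT3 : Kerr.bilin M a q e e - Kerr.bilin M a q₀ e e ≤ Lg * d * ‖e‖ * ‖e‖ := by
    have h1 : Kerr.bilin M a q e e - Kerr.bilin M a q₀ e e =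
        (Kerr.bilin M a q - Kerr.bilin M a q₀) e e := by simp only [sub_apply]
    have h2 := (abs_le.1 (abs_apply₂_le (Kerr.bilin M a q - Kerr.bilin M a q₀) e e)).2
    have h4 : ‖Kerr.bilin M a q - Kerr.bilin M a q₀‖ * ‖e‖ * ‖e‖ ≤ Lg * d * ‖e‖ * ‖e‖ :=
      mul_le_mul_of_nonneg_right (mul_le_mul_of_nonneg_right hGlip (norm_nonneg _)) (norm_nonneg _)
    rw [h1]; linarith only [h2, h4]
  -- (T4) the cross terms with `n`
  have hT4a : Kerr.bilin M a q Kq n ≤ CG * CK := by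
    have h2 := (abs_le.1 (abs_apply₂_le (Kerr.bilin M a q) Kq n)).2
    rw [hn1, mul_one] at h2
    exact h2.trans (mul_le_mul hGq hKqn (norm_nonneg _) hCG0.le)
  have hT4b : Kerr.bilin M a q e n ≤ CG * ‖e‖ := by
    have h2 := (abs_le.1 (abs_apply₂_le (Kerr.bilin M a q) e n)).2
    rw [hn1, mul_one] at h2
    exact h2.trans (mul_le_mul_of_nonneg_right hGq (norm_nonneg _))
  have hT4c : Kerr.bilin M a q n n ≤ CG := by
    have h2 := (abs_le.1 (abs_apply₂_le (Kerr.bilin M a q) n n)).2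
    rw [hn1, mul_one, mul_one] at h2
    exact h2.trans hGq
  /- ───── (B) the deviation part ───── -/
  have hKKv : 0 ≤ KΛ * Kv := mul_nonneg hKΛ0.le hKv0.le
  have hεKd : 0 ≤ ε * KΛ * d := mul_nonneg (mul_nonneg hε0.le hKΛ0.le) hd0.le
  have hKδ : 0 ≤ KΛ * ((|om| + μ) * d) :=
    mul_nonneg hKΛ0.le (mul_nonneg (add_nonneg (abs_nonneg _) hμ0.le) hd0.le)
  have hD1 : 𝓢.deviation B Φ w ((Λ : E4 ≃L[ℝ] E4) v) ((Λ : E4 ≃L[ℝ] E4) v) ≤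
      𝓢.deviation B Φ w₀ ((Λ : E4 ≃L[ℝ] E4) v) ((Λ : E4 ≃L[ℝ] E4) v) +
        ε * KΛ * d * (KΛ * Kv) * (KΛ * Kv) := by
    have h1 := bilin_sub_apply_le (𝓢.deviation B Φ w) (𝓢.deviation B Φ w₀) ((Λ : E4 ≃L[ℝ] E4) v)
      ((Λ : E4 ≃L[ℝ] E4) v)
    have h2 : ‖𝓢.deviation B Φ w - 𝓢.deviation B Φ w₀‖ * ‖(Λ : E4 ≃L[ℝ] E4) v‖ *
        ‖(Λ : E4 ≃L[ℝ] E4) v‖ ≤ ε * KΛ * d * (KΛ * Kv) * (KΛ * Kv) :=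
      mul_le_mul (mul_le_mul hDdiff hvΛ (norm_nonneg _) hεKd) hvΛ (norm_nonneg _)
        (mul_nonneg hεKd hKKv)
    linarith only [h1, h2]
  have hD2 : 𝓢.deviation B Φ w₀ ((Λ : E4 ≃L[ℝ] E4) v) ((Λ : E4 ≃L[ℝ] E4) v) ≤
      𝓢.deviation B Φ w₀ ((Λ : E4 ≃L[ℝ] E4) v₁) ((Λ : E4 ≃L[ℝ] E4) v₁) +
        2 * (ε * (KΛ * ((|om| + μ) * d)) * (KΛ * Kv)) := by
    have h1 := clm₂_self_sub (𝓢.deviation B Φ w₀) ((Λ : E4 ≃L[ℝ] E4) v) ((Λ : E4 ≃L[ℝ] E4) v₁)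
    rw [← map_sub] at h1
    have h2 := (abs_le.1 (abs_apply₂_le (𝓢.deviation B Φ w₀) ((Λ : E4 ≃L[ℝ] E4) (v - v₁))
      ((Λ : E4 ≃L[ℝ] E4) v))).2
    have h3 := (abs_le.1 (abs_apply₂_le (𝓢.deviation B Φ w₀) ((Λ : E4 ≃L[ℝ] E4) v₁)
      ((Λ : E4 ≃L[ℝ] E4) (v - v₁)))).2
    have h4 : ‖𝓢.deviation B Φ w₀‖ * ‖(Λ : E4 ≃L[ℝ] E4) (v - v₁)‖ * ‖(Λ : E4 ≃L[ℝ] E4) v‖ ≤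
        ε * (KΛ * ((|om| + μ) * d)) * (KΛ * Kv) :=
      mul_le_mul (mul_le_mul hDw₀ hδΛ (norm_nonneg _) hε0.le) hvΛ (norm_nonneg _)
        (mul_nonneg hε0.le hKδ)
    have h5 : ‖𝓢.deviation B Φ w₀‖ * ‖(Λ : E4 ≃L[ℝ] E4) v₁‖ * ‖(Λ : E4 ≃L[ℝ] E4) (v - v₁)‖ ≤
        ε * (KΛ * Kv) * (KΛ * ((|om| + μ) * d)) :=
      mul_le_mul (mul_le_mul hDw₀ hv₁Λ (norm_nonneg _) hε0.le) hδΛ (norm_nonneg _)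
        (mul_nonneg hε0.le hKKv)
    rw [h1]; linarith only [h2, h3, h4, h5]
  /- ───── (C) the metric estimate `Φ^*g_w(Λv, Λv) ≤ −(c₀/2) d` ───── -/
  have hmain : 𝓢.deviation B Φ w ((Λ : E4 ≃L[ℝ] E4) v) ((Λ : E4 ≃L[ℝ] E4) v) +
      Kerr.bilin M a q v v ≤ -(c₀ / 2 * d) := by
    have hε_le : ε * KΛ * d * (KΛ * Kv) * (KΛ * Kv) +
        2 * (ε * (KΛ * ((|om| + μ) * d)) * (KΛ * Kv)) = ε * C4 * d := by rw [← hC4def]; ring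
    have hP5 : ε * C4 * d ≤ η * C4 * d :=
      mul_le_mul_of_nonneg_right (mul_le_mul_of_nonneg_right hεη hC40.le) hd0.le
    have he2 : ‖e‖ * ‖e‖ ≤ Ce ^ 2 * η := by
      have h1 : ‖e‖ * ‖e‖ ≤ (Ce * η) * (Ce * η) :=
        mul_le_mul heCe heCe (norm_nonneg _) (mul_nonneg hCe0.le hη0.le)
      have h2 : η * η ≤ η := by nlinarith only [hη0.le, hη1]
      have h3 := mul_le_mul_of_nonneg_left h2 (sq_nonneg Ce)
      have h4 : (Ce * η) * (Ce * η) = Ce ^ 2 * (η * η) := by ring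
      linarith only [h1, h3, h4]
    have hP1 : (Lg * CK + CG * |om|) * d * ‖e‖ ≤ (Lg * CK + CG * |om|) * Ce * η * d := by
      have := mul_le_mul_of_nonneg_left heCe
        (mul_nonneg (add_nonneg (mul_nonneg hLg0 hCK0.le) (mul_nonneg hCG0.le (abs_nonneg om))) hd0.le)
      linarith only [this]
    have hP2 : Lg * d * ‖e‖ * ‖e‖ ≤ Lg * Ce ^ 2 * η * d := by
      have := mul_le_mul_of_nonneg_left he2 (mul_nonneg hLg0 hd0.le)
      have h' : Lg * d * ‖e‖ * ‖e‖ = Lg * d * (‖e‖ * ‖e‖) := by ring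
      linarith only [this, h']
    have hP3 : μ * d * (2 * Kerr.bilin M a q Kq n + 2 * Kerr.bilin M a q e n) ≤
        c₀ / 4 * d + 2 * μ * CG * Ce * η * d := by
      have h0 := mul_le_mul_of_nonneg_left heCe hCG0.le
      have h1 : 2 * Kerr.bilin M a q Kq n + 2 * Kerr.bilin M a q e n ≤
          2 * CG * CK + 2 * CG * (Ce * η) := by linarith only [hT4a, hT4b, h0]
      have h2 := mul_le_mul_of_nonneg_left h1 hμd0
      have h3 : μ * d * (2 * CG * CK + 2 * CG * (Ce * η)) =
          2 * μ * CG * CK * d + 2 * μ * CG * Ce * η * d := by ring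
      rw [hμ1] at h3
      linarith only [h2, h3]
    have hP4 : (μ * d) ^ 2 * Kerr.bilin M a q n n ≤ c₀ / 8 * d := by
      have h1 : (μ * d) ^ 2 * Kerr.bilin M a q n n ≤ (μ * d) ^ 2 * CG :=
        mul_le_mul_of_nonneg_left hT4c (sq_nonneg _)
      have h2 : (μ * d) ^ 2 * CG = μ ^ 2 * CG * d * d := by ring
      have h3 : μ ^ 2 * CG * d ≤ μ ^ 2 * CG * d₁ :=
        mul_le_mul_of_nonneg_left hdd₁ (mul_nonneg (sq_nonneg μ) hCG0.le)
      have h4 : μ ^ 2 * CG * d * d ≤ c₀ / 8 * d := mul_le_mul_of_nonneg_right (h3.trans hd₁c) hd0.le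
      linarith only [h1, h2, h4]
    have hP6 : Cη * η * d ≤ c₀ / 8 * d := mul_le_mul_of_nonneg_right hηCη hd0.le
    have hCηd : (2 * (Lg * CK + CG * |om|) * Ce + Lg * Ce ^ 2 + 2 * μ * CG * Ce + C4) * η * d =
        Cη * η * d := by rw [hCηdef]
    have hG0 : Kerr.bilin M a q₀ v₁ v₁ = 2 * Kerr.bilin M a q₀ K₀ e + Kerr.bilin M a q₀ e e := by
      rw [hGv₁, hKK0, zero_add]
    rw [hexp]
    linarith only [hD1, hD2, hv₁g, hG0, hT1, hT2, hT3, hP1, hP2, hP3, hP4, hP5, hP6, hCηd, hε_le]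
  /- ───── (D) the radial slope `dr(v) ≥ (μ/2) d` ───── -/
  have hdr : μ / 2 * d ≤ Kerr.radiusGrad a (E4.spatial q) (E4.spatial v) := by
    have h1 : Kerr.radiusGrad a (E4.spatial q) (E4.spatial v) =
        Kerr.radiusGrad a (E4.spatial q) (E4.spatial Kq) +
          Kerr.radiusGrad a (E4.spatial q) (E4.spatial e) +
          μ * d * Kerr.radiusGrad a (E4.spatial q) (E4.spatial n) := by
      rw [hv_def, map_add, map_add, map_smul, map_add, map_add, map_smul, smul_eq_mul]
    have h2 : Kerr.radiusGrad a (E4.spatial q) (E4.spatial Kq) = 0 := by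
      rw [hKq_def]; exact radiusGrad_spatial_hawkingVector M a q
    have h3 : Kerr.radiusGrad a (E4.spatial q) (E4.spatial n) = 1 := by
      rw [hn_def]; exact radiusGrad_spatial_nvec hq0
    have h4 : Kerr.radiusGrad a (E4.spatial q) (E4.spatial e) = fderiv ℝ (Kerr.radius a) q e :=
      (fderiv_radius_apply hq0 e).symm
    have h5 : Kerr.radiusGrad a (E4.spatial q₀) (E4.spatial e) = fderiv ℝ (Kerr.radius a) q₀ e :=
      (fderiv_radius_apply hq₀0 e).symm
    have h6 := hdre0
    rw [h5] at h6
    have h7a : (fderiv ℝ (Kerr.radius a) q₀ - fderiv ℝ (Kerr.radius a) q) e ≤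
        ‖fderiv ℝ (Kerr.radius a) q₀ - fderiv ℝ (Kerr.radius a) q‖ * ‖e‖ :=
      (Real.le_norm_self _).trans (ContinuousLinearMap.le_opNorm _ e)
    have h7b : ‖fderiv ℝ (Kerr.radius a) q₀ - fderiv ℝ (Kerr.radius a) q‖ =
        ‖fderiv ℝ (Kerr.radius a) q - fderiv ℝ (Kerr.radius a) q₀‖ := norm_sub_rev _ _
    have h7c : (fderiv ℝ (Kerr.radius a) q₀ - fderiv ℝ (Kerr.radius a) q) e =
        fderiv ℝ (Kerr.radius a) q₀ e - fderiv ℝ (Kerr.radius a) q e := by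
      rw [sub_apply]
    have h8 : ‖fderiv ℝ (Kerr.radius a) q - fderiv ℝ (Kerr.radius a) q₀‖ * ‖e‖ ≤ Lr * d * (Ce * η) :=
      mul_le_mul hRlip heCe (norm_nonneg _) (mul_nonneg hLr0 hd0.le)
    have h9 : Lr * d * (Ce * η) ≤ μ / 2 * d := by
      have := mul_le_mul_of_nonneg_right hηLr hd0.le
      have h' : Lr * d * (Ce * η) = Lr * Ce * η * d := by ring
      linarith only [this, h']
    rw [h7b, h7c] at h7a
    rw [h1, h2, h3, h4, zero_add, mul_one]
    linarith only [h6, h7a, h8, h9]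
  /- ───── conclusion ───── -/
  refine ⟨v, hv0, hvn, ?_, ?_⟩
  · rw [hval, hrad_w]
    have : cₛ * d ≤ c₀ / 2 * d := mul_le_mul_of_nonneg_right hcₛ1 hd0.le
    linarith only [hmain, this]
  · rw [hrad_w, hqdef]
    have : cₛ * d ≤ μ / 2 * d := mul_le_mul_of_nonneg_right hcₛ2 hd0.le
    linarith only [hdr, this]

end EngineLayer

section EngineCollar

variable (𝓢 : Spacetime.{0} 4)

/-- **(T) on a model background** — the two halves glued: `layer_slope` on `r₊ < r ≤ r₊ + d₁` and
`bulk_slope` on `r₊ + d₁ ≤ r ≤ r₊ + h`, with `ε = min`, `cₛ = min`, `K = max`.  The hypotheses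
`hBb`, `hBt`, `hBr`, `hBd` say that `B` is (a restriction of) the boosted Kerr–Schild background
`(Λ, c) · g_{M,a}` on `{r > r₊ − h}`; for `twoSidedKerrBackground Λ c M a h` they hold by `rfl`.
DRSR arXiv:1402.7034, §2.2.2; DHRT arXiv:2104.08222, §1.
[cite: DafermosRodnianskiShlapentokhrothman2014, §2.2.2] -/
theorem collarSlope_model (B : ModelBackground) (Λ : lorentzGroup) (c : E4) {M : ℝ} (a : ℝ)
    (hM : 0 < M) (ha : |a| < M) {h : ℝ} (hh : 0 < h)
    (hBb : B.bilin = boostedKerrBilin Λ c M a) (hBt : ∀ x, B.time x = poincareInv Λ c x 0)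
    (hBr : ∀ x, B.radius x = Kerr.radius a (poincareInv Λ c x))
    (hBd : ∀ z : E4, Kerr.rPlus M a - h < Kerr.radius a (poincareInv Λ c z) → z ∈ (B.domain : Set E4)) :
    ∃ ε : ℝ, 0 < ε ∧ ∃ cₛ : ℝ, 0 < cₛ ∧ ∃ K : ℝ,
    ∀ Φ : B.domain → 𝓢.carrier,
      ContMDiff 𝓘(ℝ, E4) (𝓡 4) ((⊤ : ℕ∞) : WithTop ℕ∞) Φ →
    ∀ τ₁ : ℝ,
    (∀ τ : ℝ, τ₁ ≤ τ → 𝓢.truncDeviationCk B Φ 1 (Kerr.rPlus M a + h) τ ≤ ENNReal.ofReal ε) →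
    (∀ w : B.domain, τ₁ ≤ B.time w.1 → B.radius w.1 = Kerr.rPlus M a →
      ∃ v : E4, 0 < v 0 ∧
        𝓢.metric.val (Φ w) (mfderiv 𝓘(ℝ, E4) (𝓡 4) Φ w ((Λ : E4 ≃L[ℝ] E4) v))
          (mfderiv 𝓘(ℝ, E4) (𝓡 4) Φ w ((Λ : E4 ≃L[ℝ] E4) v)) ≤ 0 ∧
        0 ≤ Kerr.radiusGrad a (E4.spatial (poincareInv Λ c w.1)) (E4.spatial v)) →
    ∀ w : B.domain, τ₁ ≤ B.time w.1 → Kerr.rPlus M a < B.radius w.1 →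
      B.radius w.1 ≤ Kerr.rPlus M a + h →
      ∃ v : E4, v 0 = 1 ∧ ‖v‖ ≤ K ∧
        𝓢.metric.val (Φ w) (mfderiv 𝓘(ℝ, E4) (𝓡 4) Φ w ((Λ : E4 ≃L[ℝ] E4) v))
          (mfderiv 𝓘(ℝ, E4) (𝓡 4) Φ w ((Λ : E4 ≃L[ℝ] E4) v)) ≤
          -(cₛ * (B.radius w.1 - Kerr.rPlus M a)) ∧
        cₛ * (B.radius w.1 - Kerr.rPlus M a) ≤
          Kerr.radiusGrad a (E4.spatial (poincareInv Λ c w.1)) (E4.spatial v) := by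
  obtain ⟨d₁, hd₁, εL, hεL, cL, hcL, KL, hL⟩ := layer_slope 𝓢 B Λ c a hM ha hh hBb hBt hBr hBd
  obtain ⟨εB, hεB, cB, hcB, KB, hB⟩ := bulk_slope 𝓢 B Λ c a hM ha.le hh hBb hBr hd₁
  refine ⟨min εL εB, lt_min hεL hεB, min cL cB, lt_min hcL hcB, max KL KB,
    fun Φ hΦ τ₁ hdev hanchor w hwt hwr1 hwr2 => ?_⟩
  have hdevL : ∀ τ : ℝ, τ₁ ≤ τ → 𝓢.truncDeviationCk B Φ 1 (Kerr.rPlus M a + h) τ ≤ ENNReal.ofReal εL :=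
    fun τ hτ => (hdev τ hτ).trans (ENNReal.ofReal_le_ofReal (min_le_left _ _))
  have hdevB : ∀ τ : ℝ, τ₁ ≤ τ → 𝓢.truncDeviationCk B Φ 1 (Kerr.rPlus M a + h) τ ≤ ENNReal.ofReal εB :=
    fun τ hτ => (hdev τ hτ).trans (ENNReal.ofReal_le_ofReal (min_le_right _ _))
  have hδ0 : 0 ≤ B.radius w.1 - Kerr.rPlus M a := by linarith
  by_cases hle : B.radius w.1 ≤ Kerr.rPlus M a + d₁
  · obtain ⟨v, hv0, hvn, hvg, hvr⟩ := hL Φ hΦ τ₁ hdevL hanchor w hwt hwr1 hle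
    have hc : min cL cB * (B.radius w.1 - Kerr.rPlus M a) ≤ cL * (B.radius w.1 - Kerr.rPlus M a) :=
      mul_le_mul_of_nonneg_right (min_le_left _ _) hδ0
    exact ⟨v, hv0, hvn.trans (le_max_left _ _), by linarith, by linarith⟩
  · obtain ⟨v, hv0, hvn, hvg, hvr⟩ := hB Φ τ₁ hdevB w hwt (not_le.1 hle).le hwr2
    have hc : min cL cB * (B.radius w.1 - Kerr.rPlus M a) ≤ cB * (B.radius w.1 - Kerr.rPlus M a) :=
      mul_le_mul_of_nonneg_right (min_le_right _ _) hδ0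
    exact ⟨v, hv0, hvn.trans (le_max_right _ _), by linarith, by linarith⟩

end EngineCollar

end KerrSlope

end Literature.Geometry.Lorentzian
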